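import Summits.AtomisticToContinuum.BoseEinsteinCondensation.Theorems.BECThomsonPrincipleFibreConductanceStubParsevalShellIdentity
import Summits.AtomisticToContinuum.BoseEinsteinCondensation.Theorems.GaussianDominationCan.Negative.CruxForms
import HarnessLib

/-!
# Route `BECThomsonPrinciple`, crux `FibreConductance` (stmt-AtomisticToContinuum-9480),
# line `parseval-shell-bootstrap` — stub `stub_parsevalShell`, part II: the PARSEVAL–SHELL BOUND

`stub_parsevalShell : ShellOccupation → FlatBound`.

By part I (`BECThomsonPrincipleFibreConductanceStubParsevalShellIdentity`), the bath-averaged flat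
corrector energy of the gradient charge is the occupation sum `Σ_{p≠0} w_p n_{p−n}(|Φ|)/N` with
`w_p = (n·(p−n))²/(|n|⁴|k_p|²)` (`ps_lintegral_fibreW_mul_flatEnergy_eq`). Here:

* the weight bound `w_p ≤ L²/‖n‖_∞² + L²/‖p‖_∞²` (`ps_weight_le`: Cauchy–Schwarz
  `(n·(p−n))² ≤ |n|²|p−n|²`, `|p−n|² ≤ 2|p|² + 2|n|²`, `‖·‖_∞² ≤ |·|₂²`);
* off the shell `‖p‖_∞ ≥ p₁` the weight is `≤ L²/‖n‖² + L²/p₁²` and `Σ_q n_q(|Φ|) = N` (Parseval in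
  the traced variable, `tsum_cellOccupation_planeWaveMode_eq`); on the shell `0 < ‖p‖_∞ < p₁` the
  INPUT `ShellOccupation` gives `n_{p−n} ≤ KN/(‖n‖²p₁)` and the lattice count of part I gives
  `(L²K/(‖n‖²p₁))·26⌈p₁⌉`;
* the window arithmetic (`ps_const_bound`): `p₁ = min(θ√ρL/2π, ‖n‖/2) ≥ min(θ/M, 1/2)·‖n‖`, so the
  total is `≤ C L²/‖n‖²` with `C = 1 + 1/c₁² + 26K(1 + 1/c₁)`, `c₁ = min(θ/M, 1/2)`.

References: the line card `Cruxes/FibreConductance/Lines/parseval-shell-bootstrap.md`; LSSY2005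
§1.2 (1.17)–(1.18) (occupations) — used only as the meaning of `cellOccupation`.
-/

noncomputable section

namespace Summit.AtomisticToContinuum.BoseEinsteinCondensation.Cruxes.FibreConductance.ParsevalShellBootstrap

open MeasureTheory
open scoped ENNReal
open Literature.MathematicalPhysics.QuantumManyBody.BoseGas
open Summit.AtomisticToContinuum.BoseEinsteinCondensation.Theorems.GaussianDominationCan.Negative
  (one_le_norm_intVec)

variable {m : ℕ} {L : ℝ}

/-! ### Real-number bookkeeping: the weights -/

/-- `‖v‖_∞² ≤ Σ_j v_j²` for an integer vector. [folklore] -/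
theorem ps_norm_sq_le_sum_sq (v : Fin 3 → ℤ) :
    ‖(fun j => (v j : ℝ))‖ ^ 2 ≤ ∑ j, (v j : ℝ) ^ 2 := by
  have h : ‖(fun j => (v j : ℝ))‖ ≤ Real.sqrt (∑ j, (v j : ℝ) ^ 2) := by
    refine (pi_norm_le_iff_of_nonneg (Real.sqrt_nonneg _)).2 fun j => ?_
    rw [Real.norm_eq_abs, ← Real.sqrt_sq_eq_abs]
    exact Real.sqrt_le_sqrt (Finset.single_le_sum (f := fun i => (v i : ℝ) ^ 2)
      (fun i _ => sq_nonneg _) (Finset.mem_univ j))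
  calc ‖(fun j => (v j : ℝ))‖ ^ 2 ≤ Real.sqrt (∑ j, (v j : ℝ) ^ 2) ^ 2 := by gcongr
    _ = ∑ j, (v j : ℝ) ^ 2 := Real.sq_sqrt (Finset.sum_nonneg fun j _ => sq_nonneg _)

/-- `2/(s (2π/L)²) ≤ L²/s'` for `0 < s' ≤ s` (`2π² ≥ 1`). [folklore] -/
theorem ps_two_div_le (hL : 0 < L) {s s' : ℝ} (hs' : 0 < s') (hss : s' ≤ s) :
    2 / (s * (2 * Real.pi / L) ^ 2) ≤ L ^ 2 / s' := by
  have hs : 0 < s := hs'.trans_le hss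
  have hπ : (1 : ℝ) ≤ 2 * Real.pi ^ 2 := by nlinarith [Real.pi_gt_three]
  have hL0 : L ≠ 0 := hL.ne'
  have hπ0 : Real.pi ≠ 0 := Real.pi_ne_zero
  have hs0 : s ≠ 0 := hs.ne'
  calc 2 / (s * (2 * Real.pi / L) ^ 2) = L ^ 2 / (2 * Real.pi ^ 2 * s) := by
        field_simp
    _ ≤ L ^ 2 / s' := by
        apply div_le_div_of_nonneg_left (sq_nonneg L) hs'
        calc s' ≤ s := hss
          _ = 1 * s := (one_mul s).symm
          _ ≤ 2 * Real.pi ^ 2 * s := mul_le_mul_of_nonneg_right hπ hs.le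

/-- **The weight bound** `w_p = (n·(p−n))²/(|n|⁴|k_p|²) ≤ L²/‖n‖_∞² + L²/‖p‖_∞²`
(Cauchy–Schwarz `(n·(p−n))² ≤ |n|²|p−n|²`, `|p−n|² ≤ 2|p|² + 2|n|²`). [folklore] -/
theorem ps_weight_le (hL : 0 < L) {n p : Fin 3 → ℤ} (hn : n ≠ 0) (hp : p ≠ 0) :
    (∑ l, (n l : ℝ) * ((p l : ℝ) - n l)) ^ 2 /
        ((∑ l, (n l : ℝ) ^ 2) ^ 2 * ((2 * Real.pi / L) ^ 2 * ∑ j, (p j : ℝ) ^ 2)) ≤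
      L ^ 2 / ‖(fun j => (n j : ℝ))‖ ^ 2 + L ^ 2 / ‖(fun j => (p j : ℝ))‖ ^ 2 := by
  have hN1 : (1 : ℝ) ≤ ‖(fun j => (n j : ℝ))‖ := one_le_norm_intVec hn
  have hP1 : (1 : ℝ) ≤ ‖(fun j => (p j : ℝ))‖ := one_le_norm_intVec hp
  have hνN : ‖(fun j => (n j : ℝ))‖ ^ 2 ≤ ∑ l, (n l : ℝ) ^ 2 := ps_norm_sq_le_sum_sq n
  have hPP : ‖(fun j => (p j : ℝ))‖ ^ 2 ≤ ∑ j, (p j : ℝ) ^ 2 := ps_norm_sq_le_sum_sq p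
  have hν : (0 : ℝ) < ∑ l, (n l : ℝ) ^ 2 := lt_of_lt_of_le (by positivity) hνN
  have hP : (0 : ℝ) < ∑ j, (p j : ℝ) ^ 2 := lt_of_lt_of_le (by positivity) hPP
  have hc : (0 : ℝ) < (2 * Real.pi / L) ^ 2 := by positivity
  have hCS : (∑ l, (n l : ℝ) * ((p l : ℝ) - n l)) ^ 2 ≤
      (∑ l, (n l : ℝ) ^ 2) * ∑ l, ((p l : ℝ) - n l) ^ 2 :=
    Finset.sum_mul_sq_le_sq_mul_sq _ _ _
  have hB : ∑ l, ((p l : ℝ) - n l) ^ 2 ≤ 2 * (∑ j, (p j : ℝ) ^ 2) + 2 * ∑ l, (n l : ℝ) ^ 2 := by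
    rw [Finset.mul_sum, Finset.mul_sum, ← Finset.sum_add_distrib]
    exact Finset.sum_le_sum fun l _ => by nlinarith [sq_nonneg ((p l : ℝ) + n l)]
  have hν0 := hν.ne'
  have hP0 := hP.ne'
  have hc0 := hc.ne'
  calc (∑ l, (n l : ℝ) * ((p l : ℝ) - n l)) ^ 2 /
          ((∑ l, (n l : ℝ) ^ 2) ^ 2 * ((2 * Real.pi / L) ^ 2 * ∑ j, (p j : ℝ) ^ 2))
        ≤ (∑ l, (n l : ℝ) ^ 2) * (2 * (∑ j, (p j : ℝ) ^ 2) + 2 * ∑ l, (n l : ℝ) ^ 2) /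
          ((∑ l, (n l : ℝ) ^ 2) ^ 2 * ((2 * Real.pi / L) ^ 2 * ∑ j, (p j : ℝ) ^ 2)) := by
        gcongr
        exact hCS.trans (mul_le_mul_of_nonneg_left hB hν.le)
    _ = 2 / ((∑ l, (n l : ℝ) ^ 2) * (2 * Real.pi / L) ^ 2) +
          2 / ((∑ j, (p j : ℝ) ^ 2) * (2 * Real.pi / L) ^ 2) := by
        field_simp
    _ ≤ L ^ 2 / ‖(fun j => (n j : ℝ))‖ ^ 2 + L ^ 2 / ‖(fun j => (p j : ℝ))‖ ^ 2 :=
        add_le_add (ps_two_div_le hL (by positivity) hνN) (ps_two_div_le hL (by positivity) hPP)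

/-- **The window arithmetic.** With `p₁ = min(θ√ρL/2π, ‖n‖/2)`, the window `2π‖n‖/L ≤ M√ρ` gives
`p₁ ≥ min(θ/M, 1/2)·‖n‖`, whence the three contributions `L²/‖n‖²`, `L²/p₁²`,
`(L²K/(‖n‖²p₁))·26R` (`R < p₁ + 1`) sum to `≤ C L²/‖n‖²` with `C = 1 + 1/c₁² + 26K(1 + 1/c₁)`,
`c₁ = min(θ/M, 1/2)`. [folklore] -/
theorem ps_const_bound {M θ K Nn ρ : ℝ} (hM : 0 < M) (hθ : 0 < θ) (hK : 0 < K) (hL : 0 < L)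
    (hN1 : 1 ≤ Nn) (hwin : 2 * Real.pi * Nn / L ≤ M * Real.sqrt ρ) {R : ℕ}
    (hR : (R : ℝ) < min (θ * Real.sqrt ρ * L / (2 * Real.pi)) (Nn / 2) + 1) :
    L ^ 2 / Nn ^ 2 + L ^ 2 / (min (θ * Real.sqrt ρ * L / (2 * Real.pi)) (Nn / 2)) ^ 2 +
        L ^ 2 * K / (Nn ^ 2 * min (θ * Real.sqrt ρ * L / (2 * Real.pi)) (Nn / 2)) * (26 * R) ≤
      (1 + 1 / (min (θ / M) (1 / 2)) ^ 2 + 26 * K * (1 + 1 / min (θ / M) (1 / 2))) *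
        L ^ 2 / Nn ^ 2 := by
  set p₁ := min (θ * Real.sqrt ρ * L / (2 * Real.pi)) (Nn / 2) with hp₁
  set c₁ := min (θ / M) (1 / 2) with hc₁
  have hc₁pos : 0 < c₁ := lt_min (by positivity) (by norm_num)
  -- key: `c₁ ‖n‖ ≤ p₁`
  have hkey : c₁ * Nn ≤ p₁ := by
    have hw' : Nn ≤ M * Real.sqrt ρ * L / (2 * Real.pi) := by
      rw [le_div_iff₀ (by positivity)]
      have := (div_le_iff₀ hL).1 hwin
      linarith
    have h1 : θ / M * Nn ≤ θ * Real.sqrt ρ * L / (2 * Real.pi) :=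
      calc θ / M * Nn ≤ θ / M * (M * Real.sqrt ρ * L / (2 * Real.pi)) :=
            mul_le_mul_of_nonneg_left hw' (by positivity)
        _ = θ * Real.sqrt ρ * L / (2 * Real.pi) := by field_simp
    have h2 : 1 / 2 * Nn ≤ Nn / 2 := by linarith
    calc c₁ * Nn = min (θ / M * Nn) (1 / 2 * Nn) := min_mul_of_nonneg _ _ (by linarith)
      _ ≤ p₁ := min_le_min h1 h2
  have hc₁p : c₁ ≤ p₁ := le_trans (by nlinarith) hkey
  have hp₁pos : 0 < p₁ := hc₁pos.trans_le hc₁p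
  have hQ : 0 ≤ L ^ 2 / Nn ^ 2 := by positivity
  -- the second term
  have h2 : L ^ 2 / p₁ ^ 2 ≤ 1 / c₁ ^ 2 * (L ^ 2 / Nn ^ 2) := by
    calc L ^ 2 / p₁ ^ 2 ≤ L ^ 2 / (c₁ * Nn) ^ 2 :=
          div_le_div_of_nonneg_left (sq_nonneg L) (by positivity) (pow_le_pow_left₀ (by positivity) hkey 2)
      _ = 1 / c₁ ^ 2 * (L ^ 2 / Nn ^ 2) := by
          field_simp
  -- the third term
  have h3 : L ^ 2 * K / (Nn ^ 2 * p₁) * (26 * R) ≤ 26 * K * (1 + 1 / c₁) * (L ^ 2 / Nn ^ 2) := by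
    have hR' : (26 : ℝ) * R ≤ 26 * (p₁ + 1) := by linarith
    calc L ^ 2 * K / (Nn ^ 2 * p₁) * (26 * R) ≤ L ^ 2 * K / (Nn ^ 2 * p₁) * (26 * (p₁ + 1)) :=
          mul_le_mul_of_nonneg_left hR' (by positivity)
      _ = 26 * K * (1 + 1 / p₁) * (L ^ 2 / Nn ^ 2) := by
          field_simp
      _ ≤ 26 * K * (1 + 1 / c₁) * (L ^ 2 / Nn ^ 2) := by
          gcongr
  calc L ^ 2 / Nn ^ 2 + L ^ 2 / p₁ ^ 2 + L ^ 2 * K / (Nn ^ 2 * p₁) * (26 * R)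
      ≤ L ^ 2 / Nn ^ 2 + 1 / c₁ ^ 2 * (L ^ 2 / Nn ^ 2) + 26 * K * (1 + 1 / c₁) * (L ^ 2 / Nn ^ 2) := by
        linarith
    _ = (1 + 1 / c₁ ^ 2 + 26 * K * (1 + 1 / c₁)) * L ^ 2 / Nn ^ 2 := by ring

/-! ### The registered stub -/

/-- **Registered stub `stub_parsevalShell` — the PARSEVAL–SHELL BOUND** `ShellOccupation → FlatBound`,
with `ρ₀ = ρ_s`, `N₀ = N_s` and `C = 1 + 1/c₁² + 26K(1 + 1/c₁)`, `c₁ = min(θ/M, 1/2)`, from the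
data `θ, ρ_s, K, N_s` of `ShellOccupation`: the bath-averaged flat energy is the occupation sum
`Σ_{p≠0} w_p n_{p−n}/N` (`ps_lintegral_fibreW_mul_flatEnergy_eq`); off the shell `‖p‖_∞ ≥ p₁`
the weights are `≤ L²/‖n‖² + L²/p₁²` and `Σ_q n_q = N`; on the shell the input occupation bound and
the lattice count give `(L²K/(‖n‖²p₁))·26⌈p₁⌉`. [folklore] -/
theorem stub_parsevalShell : Goal.stub_parsevalShell := by
  intro hS v hv hbdd M hM
  obtain ⟨θ, ρs, K, hθ, hρs, hK, Ns, hs⟩ := hS v hv hbdd M hM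
  refine ⟨ρs, 1 + 1 / (min (θ / M) (1 / 2)) ^ 2 + 26 * K * (1 + 1 / min (θ / M) (1 / 2)), hρs,
    by positivity, Ns, ?_⟩
  intro m hm L hL hρ n hn hw Φ hE hz
  have hS' := hs m hm L hL hρ n hn hw Φ hE hz
  -- the window and the admissible shell radius
  set Nn : ℝ := ‖(fun j => (n j : ℝ))‖ with hNn
  have hN1 : 1 ≤ Nn := one_le_norm_intVec hn
  set p₁ : ℝ := min (θ * Real.sqrt ((m + 1 : ℕ) / L ^ 3) * L / (2 * Real.pi)) (Nn / 2) with hp₁def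
  have hp₁ : 0 < p₁ := by
    have hρpos : (0 : ℝ) < (m + 1 : ℕ) / L ^ 3 := div_pos (Nat.cast_pos.2 m.succ_pos) (by positivity)
    exact lt_min (by positivity) (by linarith)
  set R : ℕ := ⌈p₁⌉₊ with hRdef
  have hR : (R : ℝ) < p₁ + 1 := Nat.ceil_lt_add_one hp₁.le
  -- the occupation input on the shell, at the modes `p - n`
  have hocc : ∀ p : Fin 3 → ℤ, ‖(fun j => (p j : ℝ))‖ < p₁ →
      cellOccupation (m + 1) L (planeWaveMode L (p - n)) (fun X => (‖Φ.ψ X‖ : ℂ)) ≤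
        ENNReal.ofReal (K * (m + 1 : ℕ) / (Nn ^ 2 * p₁)) := by
    intro p hp
    have h := hS' p₁ hp₁ (min_le_left _ _) (min_le_right _ _) (p - n)
    have heq : (fun j => (((p - n) j + n j : ℤ) : ℝ)) = fun j => (p j : ℝ) := by
      funext j
      simp
    rw [heq] at h
    exact h hp
  -- Parseval: `Σ_p n_{p-n}(|Φ|)/N = 1`
  have hcont : Continuous fun X : Config (m + 1) => ((‖Φ.ψ X‖ : ℝ) : ℂ) :=
    Complex.continuous_ofReal.comp Φ.contDiff.continuous.norm
  have htsum : ∑' p : Fin 3 → ℤ,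
      cellOccupation (m + 1) L (planeWaveMode L (p - n)) (fun X => (‖Φ.ψ X‖ : ℂ)) /
        (m + 1 : ℝ≥0∞) = 1 := by
    simp_rw [div_eq_mul_inv]
    have hre : ∑' p : Fin 3 → ℤ,
        cellOccupation (m + 1) L (planeWaveMode L (p - n)) (fun X => (‖Φ.ψ X‖ : ℂ)) =
          ∑' q : Fin 3 → ℤ, cellOccupation (m + 1) L (planeWaveMode L q) (fun X => (‖Φ.ψ X‖ : ℂ)) :=
      (Equiv.subRight n).tsum_eq
        (fun q => cellOccupation (m + 1) L (planeWaveMode L q) (fun X => (‖Φ.ψ X‖ : ℂ)))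
    rw [ENNReal.tsum_mul_right, hre, tsum_cellOccupation_planeWaveMode_eq hL hcont]
    have hnorm : ∫⁻ X in cellN (m + 1) L, (‖((‖Φ.ψ X‖ : ℝ) : ℂ)‖₊ : ℝ≥0∞) ^ 2 = 1 := by
      simp_rw [Complex.nnnorm_real, nnnorm_norm]
      exact Φ.norm_eq
    rw [hnorm, mul_one, Nat.cast_succ]
    exact ENNReal.mul_inv_cancel (by positivity) (by simp)
  -- the identity, then a pointwise bound on the summands
  rw [ps_lintegral_fibreW_mul_flatEnergy_eq hL hn Φ hz]
  set B : Finset (Fin 3 → ℤ) :=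
    (Fintype.piFinset fun _ : Fin 3 => Finset.Icc (-(R : ℤ)) R).erase 0 with hB
  set A : ℝ := L ^ 2 / Nn ^ 2 + L ^ 2 / p₁ ^ 2 with hA
  set D : ℝ := L ^ 2 * K / (Nn ^ 2 * p₁) with hD
  have hpt : ∀ p : Fin 3 → ℤ,
      (if p = 0 then 0 else
        ENNReal.ofReal ((∑ l, (n l : ℝ) * ((p l : ℝ) - n l)) ^ 2 /
            ((∑ l, (n l : ℝ) ^ 2) ^ 2 * ((2 * Real.pi / L) ^ 2 * ∑ j, (p j : ℝ) ^ 2))) *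
          (cellOccupation (m + 1) L (planeWaveMode L (p - n)) (fun X => (‖Φ.ψ X‖ : ℂ)) /
            (m + 1 : ℝ≥0∞))) ≤
        ENNReal.ofReal A *
            (cellOccupation (m + 1) L (planeWaveMode L (p - n)) (fun X => (‖Φ.ψ X‖ : ℂ)) /
              (m + 1 : ℝ≥0∞)) +
          if p ∈ B then ENNReal.ofReal (D / ‖(fun j => (p j : ℝ))‖ ^ 2) else 0 := by
    intro p
    by_cases hp0 : p = 0
    · simp [hp0]
    rw [if_neg hp0]
    have hwle := ps_weight_le hL hn hp0
    by_cases hpp : p₁ ≤ ‖(fun j => (p j : ℝ))‖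
    · -- off the shell: the weight is `≤ A`
      have hwA : (∑ l, (n l : ℝ) * ((p l : ℝ) - n l)) ^ 2 /
          ((∑ l, (n l : ℝ) ^ 2) ^ 2 * ((2 * Real.pi / L) ^ 2 * ∑ j, (p j : ℝ) ^ 2)) ≤ A :=
        hwle.trans (add_le_add le_rfl (div_le_div_of_nonneg_left (sq_nonneg L) (by positivity)
          (pow_le_pow_left₀ hp₁.le hpp 2)))
      calc _ ≤ ENNReal.ofReal A *
            (cellOccupation (m + 1) L (planeWaveMode L (p - n)) (fun X => (‖Φ.ψ X‖ : ℂ)) /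
              (m + 1 : ℝ≥0∞)) := by
            gcongr
        _ ≤ _ := le_self_add
    · -- on the shell: the input occupation bound
      push Not at hpp
      have hmem : p ∈ B := by
        rw [hB, Finset.mem_erase, Fintype.mem_piFinset]
        refine ⟨hp0, fun i => Finset.mem_Icc.2 ?_⟩
        have hi : |(p i : ℝ)| ≤ R :=
          ((Real.norm_eq_abs _).symm.le.trans (norm_le_pi_norm (fun j => (p j : ℝ)) i)).trans
            (hpp.le.trans (Nat.le_ceil p₁))
        rw [abs_le] at hi
        exact ⟨by exact_mod_cast hi.1, by exact_mod_cast hi.2⟩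
      rw [if_pos hmem]
      have hnp : 0 < ‖(fun j => (p j : ℝ))‖ := lt_of_lt_of_le one_pos (one_le_norm_intVec hp0)
      have hdiv : ENNReal.ofReal (K * (m + 1 : ℕ) / (Nn ^ 2 * p₁)) / (m + 1 : ℝ≥0∞) =
          ENNReal.ofReal (K / (Nn ^ 2 * p₁)) := by
        rw [show K * ((m + 1 : ℕ) : ℝ) / (Nn ^ 2 * p₁) = K / (Nn ^ 2 * p₁) * ((m + 1 : ℕ) : ℝ) by
          ring, ENNReal.ofReal_mul (by positivity), ENNReal.ofReal_natCast, Nat.cast_succ]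
        exact ENNReal.mul_div_cancel_right (by positivity) (by simp)
      calc _ ≤ ENNReal.ofReal (L ^ 2 / Nn ^ 2 + L ^ 2 / ‖(fun j => (p j : ℝ))‖ ^ 2) *
            (cellOccupation (m + 1) L (planeWaveMode L (p - n)) (fun X => (‖Φ.ψ X‖ : ℂ)) /
              (m + 1 : ℝ≥0∞)) := by
            gcongr
        _ = ENNReal.ofReal (L ^ 2 / Nn ^ 2) *
              (cellOccupation (m + 1) L (planeWaveMode L (p - n)) (fun X => (‖Φ.ψ X‖ : ℂ)) /
                (m + 1 : ℝ≥0∞)) +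
            ENNReal.ofReal (L ^ 2 / ‖(fun j => (p j : ℝ))‖ ^ 2) *
              (cellOccupation (m + 1) L (planeWaveMode L (p - n)) (fun X => (‖Φ.ψ X‖ : ℂ)) /
                (m + 1 : ℝ≥0∞)) := by
            rw [ENNReal.ofReal_add (by positivity) (by positivity), add_mul]
        _ ≤ ENNReal.ofReal A *
              (cellOccupation (m + 1) L (planeWaveMode L (p - n)) (fun X => (‖Φ.ψ X‖ : ℂ)) /
                (m + 1 : ℝ≥0∞)) +
            ENNReal.ofReal (L ^ 2 / ‖(fun j => (p j : ℝ))‖ ^ 2) *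
              (ENNReal.ofReal (K * (m + 1 : ℕ) / (Nn ^ 2 * p₁)) / (m + 1 : ℝ≥0∞)) := by
            gcongr
            · show L ^ 2 / Nn ^ 2 ≤ L ^ 2 / Nn ^ 2 + L ^ 2 / p₁ ^ 2
              exact le_add_of_nonneg_right (by positivity)
            · exact hocc p hpp
        _ = _ := by
            rw [hdiv, ← ENNReal.ofReal_mul (by positivity)]
            congr 2
            rw [hD]
            ring
  -- summation
  have hshell : ∑ p ∈ B, ENNReal.ofReal (D / ‖(fun j => (p j : ℝ))‖ ^ 2) ≤
      ENNReal.ofReal (D * (26 * R)) := by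
    rw [← ENNReal.ofReal_sum_of_nonneg (fun p _ => by positivity)]
    refine ENNReal.ofReal_le_ofReal ?_
    calc ∑ p ∈ B, D / ‖(fun j => (p j : ℝ))‖ ^ 2 = D * ∑ p ∈ B, 1 / ‖(fun j => (p j : ℝ))‖ ^ 2 := by
          rw [Finset.mul_sum]
          simp_rw [mul_one_div]
      _ ≤ D * (26 * R) := mul_le_mul_of_nonneg_left (ps_lattice_count R) (by positivity)
  have hwin : 2 * Real.pi * Nn / L ≤ M * Real.sqrt ((m + 1 : ℕ) / L ^ 3) := hw
  calc ∑' p : Fin 3 → ℤ, (if p = 0 then 0 else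
        ENNReal.ofReal ((∑ l, (n l : ℝ) * ((p l : ℝ) - n l)) ^ 2 /
            ((∑ l, (n l : ℝ) ^ 2) ^ 2 * ((2 * Real.pi / L) ^ 2 * ∑ j, (p j : ℝ) ^ 2))) *
          (cellOccupation (m + 1) L (planeWaveMode L (p - n)) (fun X => (‖Φ.ψ X‖ : ℂ)) /
            (m + 1 : ℝ≥0∞)))
      ≤ ∑' p : Fin 3 → ℤ, (ENNReal.ofReal A *
            (cellOccupation (m + 1) L (planeWaveMode L (p - n)) (fun X => (‖Φ.ψ X‖ : ℂ)) /
              (m + 1 : ℝ≥0∞)) +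
          if p ∈ B then ENNReal.ofReal (D / ‖(fun j => (p j : ℝ))‖ ^ 2) else 0) :=
        ENNReal.tsum_le_tsum hpt
    _ = ENNReal.ofReal A * ∑' p : Fin 3 → ℤ,
            (cellOccupation (m + 1) L (planeWaveMode L (p - n)) (fun X => (‖Φ.ψ X‖ : ℂ)) /
              (m + 1 : ℝ≥0∞)) +
          ∑ p ∈ B, ENNReal.ofReal (D / ‖(fun j => (p j : ℝ))‖ ^ 2) := by
        rw [ENNReal.tsum_add, ENNReal.tsum_mul_left, tsum_eq_sum (s := B) (fun p hp => if_neg hp)]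
        congr 1
        exact Finset.sum_congr rfl fun p hp => if_pos hp
    _ ≤ ENNReal.ofReal A * 1 + ENNReal.ofReal (D * (26 * R)) :=
        add_le_add (mul_le_mul' le_rfl htsum.le) hshell
    _ ≤ ENNReal.ofReal ((1 + 1 / (min (θ / M) (1 / 2)) ^ 2 + 26 * K * (1 + 1 / min (θ / M) (1 / 2))) *
          L ^ 2 / Nn ^ 2) := by
        rw [mul_one, ← ENNReal.ofReal_add (by positivity) (by positivity)]
        refine ENNReal.ofReal_le_ofReal ?_
        have h := ps_const_bound hM hθ hK hL hN1 hwin hR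
        rw [hA, hD]
        linarith [h]

end Summit.AtomisticToContinuum.BoseEinsteinCondensation.Cruxes.FibreConductance.ParsevalShellBootstrap

end
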